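import Literature.ComputerArithmetic.Shewchuk1997.Compress
import Mathlib.Tactic.Linarith
import Mathlib.Tactic.Positivity
import Mathlib.Tactic.Ring
import Mathlib.Tactic.NormNum
import Mathlib.Tactic.FieldSimp

/-!
# COMPRESS is not idempotent: a second pass shortens the output, in every precision (new work)

New work of the certified-arithmetic venture (ENGINES group: shared numerical engines serving
client cells; rigour lives in the verifiers; every published number belongs to a client cell's
ledger, not to the engines group).  Shewchuk [Shewchuk1997, §2.7 p. 331]: COMPRESS "finds a compact
form", while "Priest presents a more complicated 'Renormalization' procedure that compresses
optimally.  Its greater running time is rarely justified by the marginal reduction in expansion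
length".  THIS FILE quantifies the non-optimality for round-to-nearest-EVEN (the paper's arithmetic,
`roundTiesEven p emin`) and EVERY precision `p ≥ 3` (`emin ≤ 0`): the nonoverlapping expansion of
floats `e_p = ⟨3, −2^p, −(2^p−1)·2^(p+1)⟩` is mapped to the THREE-component
`⟨−1, −(2^p−4), −(2^p−1)·2^(p+1)⟩` (`compress_notIdem_once`: the tie `−(2^(p+1)−1)·2^p` goes to the
even `−2^(2p+1)`, the carry `2^p` meets `3` at the tie `2^p + 3 ↦ 2^p + 4`, the upward pass
re-splits), whose bottom pair `−(2^p−4) + (−1) = −(2^p−3)` is a float, so a SECOND pass returns the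
TWO-component `⟨−(2^p−3), −(2^p−1)·2^(p+1)⟩` (`compress_notIdem_twice`); hence
`compress ∘ compress ≠ compress` on valid inputs, with a strict drop in length
(`compress_not_idempotent`).  Method: replay of both
traversals with FAST-TWO-SUM exact (Theorem 6) and four evaluations of `roundTiesEven` from its
printed definition [BoldoEtAl2023, §2.2] (two ties, two strict cases); the family was found with an
integer model of the tree's `compress` (`p = 2` is non-idempotent too, by a different pattern, not
treated).  HONEST FRAMING: Theorem 23 claims neither idempotence nor minimal length, so nothing here
contradicts the paper; the point is a Lean-checked all-precision witness that one pass can leave a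
removable component.
-/

namespace Summit.Ventures.CertifiedArithmetic.Expansions

open Literature.ComputerArithmetic.JeannerodRump2018
open Literature.ComputerArithmetic.BoldoJeannerodMelquiondMuller2023 hiding twoSum twoSum_fst
open Literature.ComputerArithmetic.Shewchuk1997

variable {p : ℕ} {emin : ℤ}

/-! ### Evaluating `roundTiesEven` -/

/-- `2^m ≤ |t| < 2^(m+1)`, `emin ≤ m − p + 1` ⟹ `ulp(t) = 2^(m−p+1)`. [cite: BoldoEtAl2023, §2.1] -/
private theorem ulp_eq_of_binade {t : ℚ} {m : ℤ} (hm : emin ≤ m - p + 1) (h1 : (2 : ℚ) ^ m ≤ |t|)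
    (h2 : |t| < (2 : ℚ) ^ (m + 1)) : ulp p emin t = (2 : ℚ) ^ (m - p + 1) := by
  have hpos : 0 < |t| := lt_of_lt_of_le (zpow_pos (by norm_num) _) h1
  have ht0 : t ≠ 0 := abs_pos.mp hpos
  have hlo : m ≤ Int.log 2 |t| :=
    (Int.zpow_le_iff_le_log (b := 2) (by norm_num) hpos).mp (by exact_mod_cast h1)
  have hhi : Int.log 2 |t| < m + 1 :=
    (Int.lt_zpow_iff_log_lt (b := 2) (by norm_num) hpos).mp (by exact_mod_cast h2)
  have hlog : Int.log 2 |t| = m := le_antisymm (by omega) hlo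
  rw [ulp_of_ne_zero ht0, hlog, max_eq_right hm]

/-- The ulp on the binade `[2^(2p), 2^(2p+1))` is `2·2^p` (`emin ≤ 0`). [cite: BoldoEtAl2023] -/
private theorem ulp_big (he : emin ≤ 0) {t : ℚ} (h1 : (2 : ℚ) ^ p * 2 ^ p ≤ |t|)
    (h2 : |t| < 2 * ((2 : ℚ) ^ p * 2 ^ p)) : ulp p emin t = 2 * (2 : ℚ) ^ p := by
  have h := ulp_eq_of_binade (p := p) (emin := emin) (t := t) (m := 2 * p) (by omega)
    (by rw [show ((2 : ℤ) * p : ℤ) = ((2 * p : ℕ) : ℤ) by push_cast; ring, zpow_natCast, two_mul,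
      pow_add]; exact h1)
    (by rw [show (2 : ℤ) * p + 1 = ((2 * p + 1 : ℕ) : ℤ) by push_cast; ring, zpow_natCast,
      pow_succ, two_mul, pow_add]; linarith)
  rw [h, show (2 : ℤ) * p - p + 1 = ((p + 1 : ℕ) : ℤ) by push_cast; ring, zpow_natCast, pow_succ,
    mul_comm]

/-- The ulp on the binade `[2^p, 2^(p+1))` is `2` (`emin ≤ 1`). [cite: BoldoEtAl2023, §2.1] -/
private theorem ulp_small (he : emin ≤ 1) {t : ℚ} (h1 : (2 : ℚ) ^ p ≤ |t|)
    (h2 : |t| < 2 * (2 : ℚ) ^ p) : ulp p emin t = 2 := by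
  have h := ulp_eq_of_binade (p := p) (emin := emin) (t := t) (m := p) (by omega)
    (by rw [zpow_natCast]; exact h1)
    (by rw [show (p : ℤ) + 1 = ((p + 1 : ℕ) : ℤ) by push_cast; ring, zpow_natCast, pow_succ,
      mul_comm]; exact h2)
  rw [h, show (p : ℤ) - p + 1 = 1 by ring, zpow_one]

/-- `t = (N + r)·ulp(t)` with `0 ≤ r < 1` gives `⌊t/ulp(t)⌋ = N`. [cite: BoldoEtAl2023, §2.2] -/
private theorem rne_floor {t U r : ℚ} {N : ℤ} (hU : ulp p emin t = U) (hUpos : 0 < U)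
    (ht : t = ((N : ℚ) + r) * U) (hr0 : 0 ≤ r) (hr1 : r < 1) : ⌊t / ulp p emin t⌋ = N := by
  rw [hU, Int.floor_eq_iff, ht, mul_div_assoc, div_self hUpos.ne', mul_one]
  constructor <;> linarith

/-- `RN_e` above the midpoint: `r > ½` ⟹ `RN_e(t) = (N+1)·ulp(t)`. [cite: BoldoEtAl2023, §2.2] -/
private theorem rne_up {t U r : ℚ} {N : ℤ} (hU : ulp p emin t = U) (hUpos : 0 < U)
    (ht : t = ((N : ℚ) + r) * U) (hr0 : 0 ≤ r) (hr1 : r < 1) (hr : 1 / 2 < r) :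
    roundTiesEven p emin t = ((N : ℚ) + 1) * U := by
  have hfl := rne_floor hU hUpos ht hr0 hr1
  have e1 : t - (N : ℚ) * U = r * U := by rw [ht]; ring
  have e2 : ((N : ℚ) + 1) * U - t = (1 - r) * U := by rw [ht]; ring
  have hgt : (1 - r) * U < r * U := mul_lt_mul_of_pos_right (by linarith) hUpos
  unfold roundTiesEven
  rw [hfl, hU, e1, e2, if_neg (not_lt.mpr hgt.le), if_pos hgt]

/-- `RN_e` AT the midpoint, even `N`: `RN_e(t) = N·ulp(t)` — the printed tie rule.
[cite: BoldoEtAl2023, §2.2 (p. 212, "the one whose integral significand is even")] -/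
private theorem rne_tie_even {t U : ℚ} {N : ℤ} (hU : ulp p emin t = U) (hUpos : 0 < U)
    (ht : t = ((N : ℚ) + 1 / 2) * U) (hN : Even N) : roundTiesEven p emin t = (N : ℚ) * U := by
  have hfl := rne_floor hU hUpos ht (by norm_num) (by norm_num)
  have e1 : t - (N : ℚ) * U = 1 / 2 * U := by rw [ht]; ring
  have e2 : ((N : ℚ) + 1) * U - t = 1 / 2 * U := by rw [ht]; ring
  unfold roundTiesEven
  rw [hfl, hU, e1, e2, if_neg (lt_irrefl _), if_neg (lt_irrefl _), if_pos hN]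

/-- `RN_e` AT the midpoint, odd `N`: `RN_e(t) = (N+1)·ulp(t)`. [cite: BoldoEtAl2023, §2.2] -/
private theorem rne_tie_odd {t U : ℚ} {N : ℤ} (hU : ulp p emin t = U) (hUpos : 0 < U)
    (ht : t = ((N : ℚ) + 1 / 2) * U) (hN : ¬Even N) :
    roundTiesEven p emin t = ((N : ℚ) + 1) * U := by
  have hfl := rne_floor hU hUpos ht (by norm_num) (by norm_num)
  have e1 : t - (N : ℚ) * U = 1 / 2 * U := by rw [ht]; ring
  have e2 : ((N : ℚ) + 1) * U - t = 1 / 2 * U := by rw [ht]; ring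
  unfold roundTiesEven
  rw [hfl, hU, e1, e2, if_neg (lt_irrefl _), if_neg (lt_irrefl _), if_neg hN]

/-- FAST-TWO-SUM evaluated: floats `|b| ≤ |a|`, `fl(a + b) = s` ⟹ `(s, a + b − s)`.
[cite: Shewchuk1997, §2.3 Theorem 6] -/
private theorem f2s_eq {fl : ℚ → ℚ} (hp : 1 ≤ p) (hfl : IsRoundNearest p emin fl) {a b s : ℚ}
    (ha : IsFloat p emin a) (hb : IsFloat p emin b) (hab : |b| ≤ |a|) (hs : fl (a + b) = s) :
    fastTwoSum fl a b = (s, a + b - s) := by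
  obtain ⟨h1, -, h2, -⟩ := fastTwoSum_exact hp hfl ha hb hab
  exact Prod.ext (by rw [h1, hs]) (by rw [h2, hs])

/-- `8 ≤ 2^p` for `p ≥ 3`. [cite: Shewchuk1997, §2.1] -/
private theorem eight_le (hp : 3 ≤ p) : (8 : ℚ) ≤ (2 : ℚ) ^ p :=
  calc (8 : ℚ) = 2 ^ 3 := by norm_num
    _ ≤ 2 ^ p := pow_le_pow_right₀ (by norm_num) hp

/-- Tie 1 (downward pass, top step): `RN_e(−(2^p − 1)·2^(p+1) − 2^p) = −2^(2p+1)` — the midpoint of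
`−(2^p − 1)·2^(p+1)` (odd) and `−2^(2p+1)` (even significand `2^p·…`, scaled `N = −2^p`).
[cite: BoldoEtAl2023, §2.2; Shewchuk1997, §2.7 p. 332] -/
theorem notIdem_rne_tie_top (hp : 3 ≤ p) (he : emin ≤ 0) :
    roundTiesEven p emin (-((2 : ℚ) ^ p - 1) * (2 * 2 ^ p) + -(2 : ℚ) ^ p) =
      -(2 * ((2 : ℚ) ^ p * 2 ^ p)) := by
  have hY := eight_le hp
  have ht : -((2 : ℚ) ^ p - 1) * (2 * 2 ^ p) + -(2 : ℚ) ^ p =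
      (((-(2 ^ p : ℤ) : ℤ) : ℚ) + 1 / 2) * (2 * 2 ^ p) := by push_cast; ring
  have hU : ulp p emin (-((2 : ℚ) ^ p - 1) * (2 * 2 ^ p) + -(2 : ℚ) ^ p) = 2 * 2 ^ p := by
    refine ulp_big he ?_ ?_
    · rw [abs_of_neg (by nlinarith)]; nlinarith
    · rw [abs_of_neg (by nlinarith)]; nlinarith
  rw [rne_tie_even hU (by positivity) ht (by simpa using (Int.even_pow' (by omega)).mpr even_two)]
  push_cast; ring

/-- Tie 2 (downward pass, bottom step; and upward pass, first step): `RN_e(2^p + 3) = 2^p + 4` —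
the midpoint of `2^p + 2` (odd scaled significand `2^(p−1) + 1`) and `2^p + 4` (even).
[cite: BoldoEtAl2023, §2.2; Shewchuk1997, §2.7 p. 332] -/
theorem notIdem_rne_tie_bottom (hp : 3 ≤ p) (he : emin ≤ 0) :
    roundTiesEven p emin ((2 : ℚ) ^ p + 3) = (2 : ℚ) ^ p + 4 := by
  obtain ⟨q, rfl⟩ : ∃ q, p = q + 1 := ⟨p - 1, by omega⟩
  have hY : (4 : ℚ) ≤ 2 ^ q :=
    calc (4 : ℚ) = 2 ^ 2 := by norm_num
      _ ≤ 2 ^ q := pow_le_pow_right₀ (by norm_num) (by omega)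
  have ht : (2 : ℚ) ^ (q + 1) + 3 = ((((2 : ℤ) ^ q + 1 : ℤ) : ℚ) + 1 / 2) * 2 := by
    push_cast; ring
  have hU : ulp (q + 1) emin ((2 : ℚ) ^ (q + 1) + 3) = 2 := by
    refine ulp_small (by omega) ?_ ?_
    · rw [abs_of_pos (by positivity)]; linarith
    · rw [abs_of_pos (by positivity), pow_succ]; nlinarith
  have hodd : ¬Even ((2 : ℤ) ^ q + 1) := by
    rw [Int.not_even_iff_odd]; exact ((Int.even_pow' (by omega)).mpr even_two).add_one
  rw [rne_tie_odd hU (by norm_num) ht hodd]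
  push_cast; ring

/-- Strict case 1 (upward pass, top step; second pass, downward top step):
`RN_e(−2^(2p+1) + (2^p + 4)) = −(2^p − 1)·2^(p+1)` (`r = ½ + 2/2^p > ½`).
[cite: BoldoEtAl2023, §2.2; Shewchuk1997, §2.7 p. 332] -/
theorem notIdem_rne_up_top (hp : 3 ≤ p) (he : emin ≤ 0) :
    roundTiesEven p emin (-(2 * ((2 : ℚ) ^ p * 2 ^ p)) + ((2 : ℚ) ^ p + 4)) =
      -((2 : ℚ) ^ p - 1) * (2 * 2 ^ p) := by
  have hY := eight_le hp
  have hYpos : (0 : ℚ) < 2 ^ p := by positivity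
  have ht : -(2 * ((2 : ℚ) ^ p * 2 ^ p)) + ((2 : ℚ) ^ p + 4) =
      (((-(2 ^ p : ℤ) : ℤ) : ℚ) + (1 / 2 + 2 / 2 ^ p)) * (2 * 2 ^ p) := by
    push_cast; field_simp; ring
  have hr1 : 1 / 2 + 2 / (2 : ℚ) ^ p < 1 := by
    rw [div_add_div _ _ (by norm_num) hYpos.ne', div_lt_one (by positivity)]; nlinarith
  have hr : (1 : ℚ) / 2 < 1 / 2 + 2 / 2 ^ p := lt_add_of_pos_right _ (by positivity)
  have hU : ulp p emin (-(2 * ((2 : ℚ) ^ p * 2 ^ p)) + ((2 : ℚ) ^ p + 4)) = 2 * 2 ^ p := by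
    refine ulp_big he ?_ ?_
    · rw [abs_of_neg (by nlinarith)]; nlinarith
    · rw [abs_of_neg (by nlinarith)]; nlinarith
  rw [rne_up hU (by positivity) ht (by positivity) hr1 hr]
  push_cast; ring

/-- Strict case 2 (second pass, upward step): `RN_e(−(2^p − 1)·2^(p+1) − (2^p − 3)) =
−(2^p − 1)·2^(p+1)` (`r = ½ + 3/2^(p+1) > ½`). [cite: BoldoEtAl2023, §2.2; Shewchuk1997, §2.7] -/
theorem notIdem_rne_second_up (hp : 3 ≤ p) (he : emin ≤ 0) :
    roundTiesEven p emin (-((2 : ℚ) ^ p - 1) * (2 * 2 ^ p) + -((2 : ℚ) ^ p - 3)) =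
      -((2 : ℚ) ^ p - 1) * (2 * 2 ^ p) := by
  have hY := eight_le hp
  have hYpos : (0 : ℚ) < 2 ^ p := by positivity
  have ht : -((2 : ℚ) ^ p - 1) * (2 * 2 ^ p) + -((2 : ℚ) ^ p - 3) =
      (((-(2 ^ p : ℤ) : ℤ) : ℚ) + (1 / 2 + 3 / (2 * 2 ^ p))) * (2 * 2 ^ p) := by
    push_cast; field_simp; ring
  have hr1 : 1 / 2 + 3 / (2 * (2 : ℚ) ^ p) < 1 := by
    rw [div_add_div _ _ (by norm_num) (by positivity), div_lt_one (by positivity)]; nlinarith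
  have hr : (1 : ℚ) / 2 < 1 / 2 + 3 / (2 * 2 ^ p) := lt_add_of_pos_right _ (by positivity)
  have hU : ulp p emin (-((2 : ℚ) ^ p - 1) * (2 * 2 ^ p) + -((2 : ℚ) ^ p - 3)) = 2 * 2 ^ p := by
    refine ulp_big he ?_ ?_
    · rw [abs_of_neg (by nlinarith)]; nlinarith
    · rw [abs_of_neg (by nlinarith)]; nlinarith
  rw [rne_up hU (by positivity) ht (by positivity) hr1 hr]
  push_cast; ring

/-- The floats of the family (`p ≥ 3`, `emin ≤ 0`): `3, −2^p, T = −(2^p−1)·2^(p+1), 2^p, −2^(2p+1),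
2^p + 4 = (2^(p−2)+1)·4, −1, −(2^p−4) = −(2^(p−2)−1)·4, −(2^p−3)`. [cite: Shewchuk1997, §2.1] -/
theorem notIdem_isFloat (hp : 3 ≤ p) (he : emin ≤ 0) :
    IsFloat p emin 3 ∧ IsFloat p emin (-(2 : ℚ) ^ p) ∧
    IsFloat p emin (-((2 : ℚ) ^ p - 1) * (2 * 2 ^ p)) ∧ IsFloat p emin ((2 : ℚ) ^ p) ∧
    IsFloat p emin (-(2 * ((2 : ℚ) ^ p * 2 ^ p))) ∧ IsFloat p emin ((2 : ℚ) ^ p + 4) ∧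
    IsFloat p emin (-1) ∧ IsFloat p emin (-((2 : ℚ) ^ p - 4)) ∧
    IsFloat p emin (-((2 : ℚ) ^ p - 3)) := by
  obtain ⟨q, rfl⟩ : ∃ q, p = q + 2 := ⟨p - 2, by omega⟩
  have h8 : (8 : ℤ) ≤ 2 ^ (q + 2) :=
    calc (8 : ℤ) = 2 ^ 3 := by norm_num
      _ ≤ 2 ^ (q + 2) := pow_le_pow_right₀ (by norm_num) (by omega)
  have hq1 : (2 : ℤ) ^ q + 1 < 2 ^ (q + 2) := by
    have : (1 : ℤ) ≤ 2 ^ q := one_le_pow₀ (by norm_num)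
    rw [pow_add]; nlinarith
  have e2 : ((2 : ℚ)) ^ ((2 : ℕ) : ℤ) = 4 := by norm_num
  refine ⟨⟨3, 0, by rw [abs_of_pos (by norm_num)]; linarith, he, by norm_num⟩,
    ⟨-1, (q + 2 : ℕ), by rw [abs_neg, abs_one]; linarith, by omega, by rw [zpow_natCast]; ring⟩,
    ⟨-(2 ^ (q + 2) - 1), ((q + 3 : ℕ) : ℤ), ?_, by omega, ?_⟩,
    ⟨1, (q + 2 : ℕ), by rw [abs_one]; linarith, by omega, by rw [zpow_natCast]; ring⟩,
    ⟨-1, ((2 * q + 5 : ℕ) : ℤ), by rw [abs_neg, abs_one]; linarith, by omega, ?_⟩,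
    ⟨2 ^ q + 1, ((2 : ℕ) : ℤ), by rw [abs_of_pos (by positivity)]; exact hq1, by omega,
      by rw [e2]; push_cast; ring⟩,
    ⟨-1, 0, by rw [abs_neg, abs_one]; linarith, he, by norm_num⟩,
    ⟨-(2 ^ q - 1), ((2 : ℕ) : ℤ), ?_, by omega, by rw [e2]; push_cast; ring⟩,
    ⟨-(2 ^ (q + 2) - 3), 0, ?_, he, by norm_num⟩⟩
  · rw [abs_neg, abs_of_nonneg (by linarith)]; linarith
  · rw [zpow_natCast]; push_cast; ring
  · rw [zpow_natCast]; push_cast; ring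
  · have : (1 : ℤ) ≤ 2 ^ q := one_le_pow₀ (by norm_num)
    rw [abs_neg, abs_of_nonneg (by linarith)]; linarith
  · rw [abs_neg, abs_of_nonneg (by linarith)]; linarith

/-- The input `⟨3, −2^p, −(2^p − 1)·2^(p+1)⟩` is a nonoverlapping expansion (each component 1-below
the later ones: grids `2^p`, `2^(p+1)`). [cite: Shewchuk1997, §2.1 p. 309; Thm 23 p. 331] -/
theorem notIdem_isExpansion (hp : 3 ≤ p) :
    IsExpansion 1 [3, -(2 : ℚ) ^ p, -((2 : ℚ) ^ p - 1) * (2 * 2 ^ p)] := by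
  have hY := eight_le hp
  have gY : OnGrid (p : ℤ) (-(2 : ℚ) ^ p) := ⟨-1, by rw [zpow_natCast]; ring⟩
  have gT : OnGrid ((p : ℤ) + 1) (-((2 : ℚ) ^ p - 1) * (2 * 2 ^ p)) :=
    ⟨-(2 ^ p - 1), by rw [zpow_add_one₀ (by norm_num), zpow_natCast]; push_cast; ring⟩
  have b1 : Below 1 3 (-(2 : ℚ) ^ p) :=
    ⟨p, gY, by rw [zpow_natCast, abs_of_pos (by norm_num)]; linarith⟩
  have i2 : 1 * |(3 : ℚ)| < (2 : ℚ) ^ ((p : ℤ) + 1) := by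
    rw [zpow_add_one₀ (by norm_num), zpow_natCast, abs_of_pos (by norm_num)]; linarith
  have b2 : Below 1 3 (-((2 : ℚ) ^ p - 1) * (2 * 2 ^ p)) := ⟨(p : ℤ) + 1, gT, i2⟩
  have i3 : 1 * |(-(2 : ℚ) ^ p)| < (2 : ℚ) ^ ((p : ℤ) + 1) := by
    rw [zpow_add_one₀ (by norm_num), zpow_natCast, abs_neg, abs_of_pos (by positivity)]; linarith
  have b3 : Below 1 (-(2 : ℚ) ^ p) (-((2 : ℚ) ^ p - 1) * (2 * 2 ^ p)) := ⟨(p : ℤ) + 1, gT, i3⟩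
  simp only [IsExpansion]
  refine List.Pairwise.cons ?_ (List.Pairwise.cons ?_ (List.pairwise_singleton _ _))
  · intro y hy
    simp only [List.mem_cons, List.not_mem_nil, or_false] at hy
    rcases hy with rfl | rfl
    exacts [b1, b2]
  · intro y hy
    simp only [List.mem_cons, List.not_mem_nil, or_false] at hy
    subst hy
    exact b3

/-! ### The two passes -/

/-- **First pass**: `COMPRESS⟨3, −2^p, −(2^p−1)·2^(p+1)⟩ = ⟨−1, −(2^p − 4), −(2^p−1)·2^(p+1)⟩`
(round-to-even, `p ≥ 3`). Downward `(−2^(2p+1), 2^p)` [tie], `(2^p + 4, −1)` [tie]; upward emits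
`−1`, then `(T, −(2^p − 4))` emits `−(2^p − 4)`, top `T`. [cite: Shewchuk1997, §2.7, Thm 6] -/
theorem compress_notIdem_once (hp : 3 ≤ p) (he : emin ≤ 0) :
    compress (roundTiesEven p emin) [3, -(2 : ℚ) ^ p, -((2 : ℚ) ^ p - 1) * (2 * 2 ^ p)] =
      [-1, -((2 : ℚ) ^ p - 4), -((2 : ℚ) ^ p - 1) * (2 * 2 ^ p)] := by
  have hp1 : 1 ≤ p := by omega
  have hY := eight_le hp
  have hfl := isRoundNearest_roundTiesEven (p := p) (emin := emin) hp1
  obtain ⟨f3, fY, fT, fYp, f2YY, fY4, f1, fY4m, -⟩ := notIdem_isFloat hp he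
  -- the four FAST-TWO-SUMs of the first pass
  have a1 : |(-(2 : ℚ) ^ p)| ≤ |(-((2 : ℚ) ^ p - 1) * (2 * 2 ^ p))| := by
    rw [abs_neg, abs_of_pos (by positivity), abs_of_neg (by nlinarith)]; nlinarith
  have F1 : fastTwoSum (roundTiesEven p emin) (-((2 : ℚ) ^ p - 1) * (2 * 2 ^ p)) (-(2 : ℚ) ^ p) =
      (-(2 * ((2 : ℚ) ^ p * 2 ^ p)), (2 : ℚ) ^ p) := by
    rw [f2s_eq hp1 hfl fT fY a1 (notIdem_rne_tie_top hp he)]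
    ring_nf
  have a2 : |(3 : ℚ)| ≤ |((2 : ℚ) ^ p)| := by
    rw [abs_of_pos (by norm_num), abs_of_pos (by positivity)]; linarith
  have F2 : fastTwoSum (roundTiesEven p emin) ((2 : ℚ) ^ p) 3 = ((2 : ℚ) ^ p + 4, -1) := by
    rw [f2s_eq hp1 hfl fYp f3 a2 (notIdem_rne_tie_bottom hp he)]
    ring_nf
  have a3 : |(-1 : ℚ)| ≤ |((2 : ℚ) ^ p + 4)| := by
    rw [abs_neg, abs_one, abs_of_pos (by positivity)]; linarith
  have r3 : roundTiesEven p emin ((2 : ℚ) ^ p + 4 + -1) = (2 : ℚ) ^ p + 4 := by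
    rw [show (2 : ℚ) ^ p + 4 + -1 = 2 ^ p + 3 by ring]
    exact notIdem_rne_tie_bottom hp he
  have F3 : fastTwoSum (roundTiesEven p emin) ((2 : ℚ) ^ p + 4) (-1) = ((2 : ℚ) ^ p + 4, -1) := by
    rw [f2s_eq hp1 hfl fY4 f1 a3 r3]
    ring_nf
  have a4 : |((2 : ℚ) ^ p + 4)| ≤ |(-(2 * ((2 : ℚ) ^ p * 2 ^ p)))| := by
    rw [abs_of_pos (by positivity), abs_of_neg (by nlinarith)]; nlinarith
  have F4 : fastTwoSum (roundTiesEven p emin) (-(2 * ((2 : ℚ) ^ p * 2 ^ p))) ((2 : ℚ) ^ p + 4) =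
      (-((2 : ℚ) ^ p - 1) * (2 * 2 ^ p), -((2 : ℚ) ^ p - 4)) := by
    rw [f2s_eq hp1 hfl f2YY fY4 a4 (notIdem_rne_up_top hp he)]
    ring_nf
  -- downward pass
  have hD : compressDown (roundTiesEven p emin) (-((2 : ℚ) ^ p - 1) * (2 * 2 ^ p))
      [-(2 : ℚ) ^ p, 3] = ([-(2 * ((2 : ℚ) ^ p * 2 ^ p)), (2 : ℚ) ^ p + 4], -1) := by
    rw [compressDown_cons_of_ne_zero (by rw [F1]; positivity), F1]
    simp only
    rw [compressDown_cons_of_ne_zero (by rw [F2]; norm_num), F2]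
    simp
  -- upward pass
  have hc : compress (roundTiesEven p emin) [3, -(2 : ℚ) ^ p, -((2 : ℚ) ^ p - 1) * (2 * 2 ^ p)] =
      compressUp (roundTiesEven p emin) (-1) [(2 : ℚ) ^ p + 4, -(2 * ((2 : ℚ) ^ p * 2 ^ p))] := by
    simp only [compress, List.reverse_cons, List.reverse_nil, List.nil_append, List.cons_append,
      hD]
  rw [hc, compressUp_cons_of_ne_zero (by rw [F3]; norm_num), F3]
  simp only
  rw [compressUp_cons_of_ne_zero (by rw [F4]; simp only; linarith), F4]
  simp

/-- **Second pass**: `COMPRESS⟨−1, −(2^p − 4), T⟩ = ⟨−(2^p − 3), T⟩` (`T = −(2^p−1)·2^(p+1)`,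
round-to-even, `p ≥ 3`): the downward pass emits `T` and then absorbs `−1` into `−(2^p − 4)`
EXACTLY (`−(2^p − 3)` is a float), and the upward pass keeps the pair.
[cite: Shewchuk1997, §2.7 p. 332 (COMPRESS), §2.3 Theorem 6] -/
theorem compress_notIdem_twice (hp : 3 ≤ p) (he : emin ≤ 0) :
    compress (roundTiesEven p emin) [-1, -((2 : ℚ) ^ p - 4), -((2 : ℚ) ^ p - 1) * (2 * 2 ^ p)] =
      [-((2 : ℚ) ^ p - 3), -((2 : ℚ) ^ p - 1) * (2 * 2 ^ p)] := by
  have hp1 : 1 ≤ p := by omega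
  have hY := eight_le hp
  have hfl := isRoundNearest_roundTiesEven (p := p) (emin := emin) hp1
  obtain ⟨-, -, fT, -, -, -, f1, fY4m, fY3m⟩ := notIdem_isFloat hp he
  have a5 : |(-((2 : ℚ) ^ p - 4))| ≤ |(-((2 : ℚ) ^ p - 1) * (2 * 2 ^ p))| := by
    rw [abs_of_neg (by linarith), abs_of_neg (by nlinarith)]; nlinarith
  have r5 : roundTiesEven p emin (-((2 : ℚ) ^ p - 1) * (2 * 2 ^ p) + -((2 : ℚ) ^ p - 4)) =
      -((2 : ℚ) ^ p - 1) * (2 * 2 ^ p) := by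
    rw [show -((2 : ℚ) ^ p - 1) * (2 * 2 ^ p) + -((2 : ℚ) ^ p - 4) =
      -(2 * ((2 : ℚ) ^ p * 2 ^ p)) + ((2 : ℚ) ^ p + 4) by ring]
    exact notIdem_rne_up_top hp he
  have G1 : fastTwoSum (roundTiesEven p emin) (-((2 : ℚ) ^ p - 1) * (2 * 2 ^ p))
      (-((2 : ℚ) ^ p - 4)) = (-((2 : ℚ) ^ p - 1) * (2 * 2 ^ p), -((2 : ℚ) ^ p - 4)) := by
    rw [f2s_eq hp1 hfl fT fY4m a5 r5]
    ring_nf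
  have a6 : |(-1 : ℚ)| ≤ |(-((2 : ℚ) ^ p - 4))| := by
    rw [abs_neg, abs_one, abs_of_neg (by linarith)]; linarith
  have r6 : roundTiesEven p emin (-((2 : ℚ) ^ p - 4) + -1) = -((2 : ℚ) ^ p - 3) := by
    rw [show -((2 : ℚ) ^ p - 4) + -1 = -((2 : ℚ) ^ p - 3) by ring]
    exact roundTiesEven_eq_self hp1 fY3m
  have G2 : fastTwoSum (roundTiesEven p emin) (-((2 : ℚ) ^ p - 4)) (-1) =
      (-((2 : ℚ) ^ p - 3), 0) := by
    rw [f2s_eq hp1 hfl fY4m f1 a6 r6]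
    ring_nf
  have a7 : |(-((2 : ℚ) ^ p - 3))| ≤ |(-((2 : ℚ) ^ p - 1) * (2 * 2 ^ p))| := by
    rw [abs_of_neg (by linarith), abs_of_neg (by nlinarith)]; nlinarith
  have G3 : fastTwoSum (roundTiesEven p emin) (-((2 : ℚ) ^ p - 1) * (2 * 2 ^ p))
      (-((2 : ℚ) ^ p - 3)) = (-((2 : ℚ) ^ p - 1) * (2 * 2 ^ p), -((2 : ℚ) ^ p - 3)) := by
    rw [f2s_eq hp1 hfl fT fY3m a7 (notIdem_rne_second_up hp he)]
    ring_nf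
  have hD : compressDown (roundTiesEven p emin) (-((2 : ℚ) ^ p - 1) * (2 * 2 ^ p))
      [-((2 : ℚ) ^ p - 4), -1] = ([-((2 : ℚ) ^ p - 1) * (2 * 2 ^ p)], -((2 : ℚ) ^ p - 3)) := by
    rw [compressDown_cons_of_ne_zero (by rw [G1]; simp only; linarith), G1]
    simp only
    rw [compressDown_cons_of_eq_zero (by rw [G2]), G2]
    simp
  have hc : compress (roundTiesEven p emin)
      [-1, -((2 : ℚ) ^ p - 4), -((2 : ℚ) ^ p - 1) * (2 * 2 ^ p)] =
      compressUp (roundTiesEven p emin) (-((2 : ℚ) ^ p - 3))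
        [-((2 : ℚ) ^ p - 1) * (2 * 2 ^ p)] := by
    simp only [compress, List.reverse_cons, List.reverse_nil, List.nil_append, List.cons_append,
      hD]
  rw [hc, compressUp_cons_of_ne_zero (by rw [G3]; simp only; linarith), G3]
  simp

/-- **COMPRESS is not idempotent** (round-to-even, every precision `p ≥ 3`, `emin ≤ 0`): some
nonoverlapping expansion of floats has a COMPRESS output that a second COMPRESS shortens (3 then 2
components). [cite: Shewchuk1997, §2.7 p. 331 ("Priest ... compresses optimally ... marginal")] -/
theorem compress_not_idempotent (hp : 3 ≤ p) (he : emin ≤ 0) :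
    ∃ e : List ℚ, (∀ x ∈ e, IsFloat p emin x) ∧ IsExpansion 1 e ∧
      compress (roundTiesEven p emin) (compress (roundTiesEven p emin) e) ≠
        compress (roundTiesEven p emin) e ∧
      (compress (roundTiesEven p emin) (compress (roundTiesEven p emin) e)).length = 2 ∧
      (compress (roundTiesEven p emin) e).length = 3 ∧ e.length = 3 := by
  obtain ⟨f3, fY, fT, -⟩ := notIdem_isFloat hp he
  refine ⟨[3, -(2 : ℚ) ^ p, -((2 : ℚ) ^ p - 1) * (2 * 2 ^ p)], ?_, notIdem_isExpansion hp, ?_, ?_,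
    ?_, rfl⟩
  · intro x hx
    simp only [List.mem_cons, List.not_mem_nil, or_false] at hx
    rcases hx with rfl | rfl | rfl
    exacts [f3, fY, fT]
  · rw [compress_notIdem_once hp he, compress_notIdem_twice hp he]; simp
  · rw [compress_notIdem_once hp he, compress_notIdem_twice hp he]; simp
  · rw [compress_notIdem_once hp he]; simp

/-- SANITY CHECK `p = 3`, `emin = 0` (the general theorems evaluated; matches the integer model that
found the family): `⟨3, −8, −112⟩ ↦ ⟨−1, −4, −112⟩ ↦ ⟨−5, −112⟩`. [cite: Shewchuk1997, §2.7] -/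
example : compress (roundTiesEven 3 0) [3, -8, -112] = [-1, -4, -112] ∧
    compress (roundTiesEven 3 0) [-1, -4, -112] = [-5, -112] := by
  have h1 := compress_notIdem_once (p := 3) (emin := 0) le_rfl le_rfl
  have h2 := compress_notIdem_twice (p := 3) (emin := 0) le_rfl le_rfl
  norm_num at h1 h2
  exact ⟨h1, h2⟩

end Summit.Ventures.CertifiedArithmetic.Expansions
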